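import Summits.NavierStokesRegularity.NavierStokesRegularity.Theses.AxisymmetricExtremality
import Summits.NavierStokesRegularity.NavierStokesRegularity.Theorems.AxisymmetricExtremalityAxisymmetricKatoGlobalStubSeregin2020TypeIINoSwirlReduction
import Summits.NavierStokesRegularity.NavierStokesRegularity.Theorems.AxisymmetricExtremalityAxisymmetricKatoGlobalStubSeregin2020TypeIINoSwirlCore
import HarnessLib

/-!
# Seregin 2020, proof of Thm 2.1, the no-swirl endgame, UNCONDITIONAL: a swirl-free
# axisymmetric local energy ancient solution has no backward singular point; the endgame
# after `Γ ≡ 0`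

Helper toward the stub `stub_seregin2020TypeII` of the crux `AxisymmetricKatoGlobal` (= the named
fact `Literature.Analysis.FluidPDE.Seregin2020_axisymmetricSingularPoint_typeII`, G. Seregin,
Anal. Math. Phys. 10 (2020) Paper 46 = arXiv:2006.04140, Thm 2.1), last paragraph of the
printed proof (arXiv p. 8): "`Γ = 0` and, therefore, `u_φ = 0` … any axially symmetric
suitable weak solution with no swirl … is smooth … In particular, the function `u` is a
continuous function in `Q̄(R)` for any `R > 0`. The latter contradicts restriction (2.9)". The
sibling `…NoSwirlReduction` reduced this endgame to ONE hypothesis `hcore` (no point of the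
backward-singular set has a clean parabolic past), and the sibling `…NoSwirlCore` proved it
(`clean_point_backwardRegular`). This file records the two unconditional conclusions:

* `not_isBackwardSingularPoint_of_hasNoSwirl` — an Albritton–Barker suitable weak solution in
  every `Q(a)` with axisymmetric, swirl-free slices is NOT backward singular at the origin
  (Ladyzhenskaya / Ukhovskii–Yudovich regularity of swirl-free axisymmetric flows, in the local
  backward form of the blow-up limit);
* `false_of_ae_swirl_eq_zero` — the endgame after the `Γ ≡ 0` step: (𝒜), (2.9), the backward
  singular origin, and `swirl = 0` a.e. on every `Q(a)`, are contradictory.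

What is left between the tree and `Seregin2020_axisymmetricSingularPoint_typeII_holds` is the
`Γ ≡ 0` step itself (Lemma 2.2 of the paper, a Nazarov–Uraltseva weak Harnack inequality with
divergence-free `L^∞ BMO⁻¹` drift, and the oscillation-decay argument at the axis).

## References

* G. Seregin, Anal. Math. Phys. 10 (2020), Paper 46 = arXiv:2006.04140, proof of Thm. 2.1, last
  paragraph (arXiv p. 8). [Seregin2020]
-/

-- the problem directory repeats the summit name (D-0017); core's `dupNamespace` linter fires
set_option linter.dupNamespace false

noncomputable section

open MeasureTheory Set Function Filter Topology TopologicalSpace Metric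
open scoped NNReal ENNReal

namespace Summit.NavierStokesRegularity.NavierStokesRegularity.Theorems.AxisymmetricKatoGlobal.EulerScaling

open Literature.Analysis.FluidPDE Literature.Analysis.FluidPDE.Seregin2020

/-- **Swirl-free axisymmetric local energy ancient solutions are backward regular at the
origin.** Let `(w, π)` be an Albritton–Barker suitable weak solution in every `Q(a)`, `a > 0`,
all of whose slices are axisymmetric and swirl free. Then the origin is not a backward
singular point of `w` (`not_isBackwardSingularPoint_of_forall_clean` fed with the analytic
core `clean_point_backwardRegular`). [cite: Seregin2020, proof of Thm 2.1, last paragraph (arXiv p. 8)] -/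
theorem not_isBackwardSingularPoint_of_hasNoSwirl :
    ∀ (w : ℝ → EuclideanSpace ℝ (Fin 3) → EuclideanSpace ℝ (Fin 3))
      (π : ℝ → EuclideanSpace ℝ (Fin 3) → ℝ), (∀ s, IsAxisymmetric (w s)) →
      (∀ s, HasNoSwirl (w s)) →
      (∀ a : ℝ, 0 < a → IsSuitableWeakSolutionInBall a 0 w π) →
      ¬ IsBackwardSingularPoint w 0 := by
  intro w π hax hns hball
  exact not_isBackwardSingularPoint_of_forall_clean w π hax hball
    (clean_point_backwardRegular w π hax hns hball)

/-- **Seregin 2020, proof of Thm 2.1, the endgame after `Γ ≡ 0`, unconditional.** Let `(w, π)`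
have the properties (𝒜)(i)–(iii), (2.9) as delivered by `exists_ancientLimit_isAxisymmetric`
(axisymmetric slices, backward singular origin, the `∀ a > 0` block), and let the swirl of `w`
vanish a.e. on every `Q(a)` (the `Γ ≡ 0` step). Then we have a contradiction: the swirl-free
normal form `(s, y) ↦ poloidalPart (w s) y` keeps the class, the symmetry and the backward
singular origin (`ancientLimit_poloidalPart`) and is swirl free at every point, hence backward
regular at the origin (`clean_point_backwardRegular` through
`false_of_ae_swirl_eq_zero_of_forall_clean`) — "the latter contradicts restriction (2.9)".
[cite: Seregin2020, proof of Thm 2.1, last paragraph (arXiv p. 8)] -/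
theorem false_of_ae_swirl_eq_zero :
    ∀ (u w : ℝ → EuclideanSpace ℝ (Fin 3) → EuclideanSpace ℝ (Fin 3))
      (p π : ℝ → EuclideanSpace ℝ (Fin 3) → ℝ) (K : ℝ≥0) (κ : ℝ) (lam : ℕ → ℝ),
      (∀ s, IsAxisymmetric (w s)) → IsBackwardSingularPoint w 0 →
      (∀ a : ℝ, 0 < a →
        IsSuitableWeakSolutionInBall a 0 w π ∧
        MemLp (uncurry w) 3
          (volume.restrict (parabolicCylinder a (0 : ℝ × EuclideanSpace ℝ (Fin 3)))) ∧
        Tendsto (fun j => eLpNorm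
            (uncurry ((lam j) • stPull ((lam j) ^ 2) (lam j) (0 : ℝ)
              (0 : EuclideanSpace ℝ (Fin 3)) u) - uncurry w) 3
            (volume.restrict (parabolicCylinder a (0 : ℝ × EuclideanSpace ℝ (Fin 3)))))
          atTop (𝓝 0) ∧
        (∀ g : ℝ × EuclideanSpace ℝ (Fin 3) → ℝ,
          MemLp g 3 (volume.restrict (parabolicCylinder a (0 : ℝ × EuclideanSpace ℝ (Fin 3)))) →
          Tendsto (fun j => ∫ w' in parabolicCylinder a (0 : ℝ × EuclideanSpace ℝ (Fin 3)),
              ((lam j) ^ 2 • stPull ((lam j) ^ 2) (lam j) (0 : ℝ)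
                (0 : EuclideanSpace ℝ (Fin 3)) p) w'.1 w'.2 * g w')
            atTop (𝓝 (∫ w' in parabolicCylinder a (0 : ℝ × EuclideanSpace ℝ (Fin 3)),
              π w'.1 w'.2 * g w'))) ∧
        cknAEss a (0 : ℝ × EuclideanSpace ℝ (Fin 3)) w ≤ K ∧
        cknC a (0 : ℝ × EuclideanSpace ℝ (Fin 3)) w ≤ K ∧
        cknD a (0 : ℝ × EuclideanSpace ℝ (Fin 3)) π ≤ K ∧
        (∃ G' : ℝ → EuclideanSpace ℝ (Fin 3) →
            EuclideanSpace ℝ (Fin 3) →L[ℝ] EuclideanSpace ℝ (Fin 3),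
          HasWeakSpatialGradientOn
              (parabolicCylinderOpens (2 * a) (0 : ℝ × EuclideanSpace ℝ (Fin 3))) w G' ∧
            cknAEss a (0 : ℝ × EuclideanSpace ℝ (Fin 3)) w +
              cknE a (0 : ℝ × EuclideanSpace ℝ (Fin 3)) G' ≤ K) ∧
        ENNReal.ofReal κ ≤ cknC a (0 : ℝ × EuclideanSpace ℝ (Fin 3)) w) →
      (∀ a : ℝ, 0 < a →
        ∀ᵐ z ∂(volume.restrict (parabolicCylinder a (0 : ℝ × EuclideanSpace ℝ (Fin 3)))),
          swirl (w z.1) z.2 = 0) →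
      False := by
  intro u w p π K κ lam hax hsing hall hsw
  obtain ⟨hax', hns', -, hall'⟩ := ancientLimit_poloidalPart hax hsing hall hsw
  exact false_of_ae_swirl_eq_zero_of_forall_clean u w p π K κ lam hax hsing hall hsw
    (clean_point_backwardRegular _ π hax' hns' fun a ha => (hall' a ha).1)

end Summit.NavierStokesRegularity.NavierStokesRegularity.Theorems.AxisymmetricKatoGlobal.EulerScaling

end
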